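import Summits.BirchSwinnertonDyer.BirchSwinnertonDyer.Theorems.CMKolyvaginAtInertTwoCMKolyvaginConjectureAtInertTwoPositiveDepthDatumFreeAllLevels
import Summits.BirchSwinnertonDyer.BirchSwinnertonDyer.Theses.CMKolyvaginAtInertTwo
import HarnessLib

/-!
# Crux `CMKolyvaginConjectureAtInertTwo` (stmt-BirchSwinnertonDyer-24648):
# THE CRUX DECL BY NAME IS EQUIVALENT TO ITS CANONICAL (DATUM-FREE) FORM; SHALLOW = `ℓ ≡ 1 (mod 4)` ON CM-INERT PRIMES

Route `CMKolyvaginAtInertTwo` (cell `pub/bsd-eis`, seat `leafhand-bsd-cmkolyvaginatinert-2` g0); helper (`--supports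
stmt-BirchSwinnertonDyer-24648 --as helper`). THEOREMS ONLY (no definition, no named fact, no `sorry`); closes nothing;
BSD is proved for no curve. Sequel of this seat's p799182 (`…PositiveDepthDatumFreeAllLevels`) and p799717
(`…DeepDivisibleOfBSDTwo`, used only in a docstring remark).

* §1 `cmKolyvaginConjectureAtInertTwo_iff_forall_data` — **`CMKolyvaginConjectureAtInertTwo` (BY NAME) ⟺ its CANONICAL
  form**: on every H₂ frame some square-free product `n` of Zhang–Kolyvagin primes at `2` inert in `F` admits data and EVERY
  datum of conductor `n` has `P(n) ∉ 2E(K[n])` (p799182 `conclusion_iff_forall_data`, frame by frame) — the form a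
  restatement or a refuter should use: the witness LEVEL is a property of the frame `(W, K, Dt, β, ι)` alone.
* §2 `kolyvaginIndex_two_lt_two_iff_mod_four_eq_one` — for a CM-inert Zhang–Kolyvagin prime `ℓ` at `2` on a globally
  minimal CM curve: `M(ℓ) < 2 ⟺ ℓ ≡ 1 (mod 4)` (Deuring `a_ℓ = 0`, tree `Rank1Residual.frobeniusTrace_eq_zero_of_hasCM_of_cmInert`,
  so `M(ℓ) = v₂(ℓ+1)`). With p799717 (`exists_shallow_witness_of_cmKolyvaginConjectureAtInertTwo_of_bsdp_of_prints`) the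
  shallow disjunct there reads in CONGRUENCE form: granted BSD₂(E) and the five prints, on every `Σ ≥ 2` H₂ Heegner frame the
  crux's witness `(n, d)` has a prime factor `ℓ ≡ 1 (mod 4)` or one with `Frob_ℓ ≠ Frob_∞` on `K(E[4])` — and at a prime level
  `ℓ ≡ 1 (mod 4)` this seat's `…ShallowGenusDescent` applies. (Not restated here, to keep this file off the BSD-conditional cone.)

HONEST FRAMING: bookkeeping over landed theorems; the open mathematics (Kolyvagin's non-vanishing at `2` on H₂) is untouched;
no stub is closed; BSD is proved for no curve.
[cite: GrossLMS1991, §4 (4.1) and the remark that [P_n] is independent of S] [cite: WZhang2014, Notations (xii), §3.7]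
-/

set_option linter.dupNamespace false -- `Summit.BirchSwinnertonDyer.BirchSwinnertonDyer.Theorems.…` (summit = sub)
set_option autoImplicit false

noncomputable section

open scoped Classical

namespace Summit.BirchSwinnertonDyer.BirchSwinnertonDyer.Theorems.CMKolyvaginConjecturePositiveDepth

open WeierstrassCurve NumberField Literature.NumberTheory.EllipticCurves
  Literature.NumberTheory.EllipticCurves.ModularForms
  Literature.NumberTheory.EllipticCurves.Rank1Residual
open Summit.BirchSwinnertonDyer.BirchSwinnertonDyer.Theses.CMKolyvaginAtInertTwo (CMKolyvaginConjectureAtInertTwo)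
open Summit.BirchSwinnertonDyer.BirchSwinnertonDyer.Theorems

/-! ## §1 The crux by name ⟺ its canonical form -/

/-- **Crux 24648 ⟹ its canonical form**: on every H₂ frame of the crux, some square-free product `n` of Zhang–Kolyvagin primes
at `2` inert in `F` admits data and EVERY datum of conductor `n` has `P(n) ∉ 2E(K[n])` (p799182 `conclusion_iff_forall_data`).
[cite: GrossLMS1991, §4 (4.1)] -/
theorem forall_data_of_cmKolyvaginConjectureAtInertTwo (hKC : CMKolyvaginConjectureAtInertTwo) :
    ∀ (W : WeierstrassCurve ℚ) [W.IsElliptic] [W.IsGloballyMinimal] [NeZero (W.conductorNorm ℤ)], W.HasCM →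
      CMInert W 2 → W.HasSurjectiveModNGaloisRep (2 : ℤ) → W.analyticRank = 1 → Odd W.tamagawaProduct →
      ∀ (K : Type) [Field K] [NumberField K], IsImaginaryQuadratic K → Odd (NumberField.discr K) →
        NumberField.discr K ≠ -3 → SatisfiesHeegnerHypothesis (W.conductorNorm ℤ) K →
        ∀ (Dt : ModularParametrizationData W (W.conductorNorm ℤ)),
          (∀ z ∈ Dt.L.lattice, ∃ w ∈ periodLattice Dt.f, z = (Dt.c : ℂ) * w) → Odd Dt.c →
          ∀ (β : ℤ) (ι : K →+* ℂ) (d₁ : KolyvaginHeegnerData Dt β ι 1), ¬ IsOfFinAddOrder d₁.derivedPoint →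
            ∃ n : ℕ, Squarefree n ∧
              (∀ ℓ ∈ n.primeFactors, Zhang2014.IsKolyvaginPrime (W.conductorNorm ℤ) W K 2 ℓ ∧ CMInert W ℓ) ∧
              Nonempty (KolyvaginHeegnerData Dt β ι n) ∧
              ∀ d : KolyvaginHeegnerData Dt β ι n,
                ¬ ∃ Q : (W.baseChange (ringClassField K ι n)).toAffine.Point, (2 : ℤ) • Q = d.derivedPoint := by
  intro W _ _ _ hCM hin hρ hr hT K _ _ hK hodd h3 hH Dt hDt hc β ι d₁ hy
  exact (conclusion_iff_forall_data W hCM hK hodd h3 hH d₁).mp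
    (hKC W hCM hin hρ hr hT K hK hodd h3 hH Dt hDt hc β ι d₁ hy)

/-- **The canonical form ⟹ crux 24648** (pick any datum at the witness level). [cite: GrossLMS1991, §4 (4.1)] -/
theorem cmKolyvaginConjectureAtInertTwo_of_forall_data
    (h : ∀ (W : WeierstrassCurve ℚ) [W.IsElliptic] [W.IsGloballyMinimal] [NeZero (W.conductorNorm ℤ)], W.HasCM →
      CMInert W 2 → W.HasSurjectiveModNGaloisRep (2 : ℤ) → W.analyticRank = 1 → Odd W.tamagawaProduct →
      ∀ (K : Type) [Field K] [NumberField K], IsImaginaryQuadratic K → Odd (NumberField.discr K) →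
        NumberField.discr K ≠ -3 → SatisfiesHeegnerHypothesis (W.conductorNorm ℤ) K →
        ∀ (Dt : ModularParametrizationData W (W.conductorNorm ℤ)),
          (∀ z ∈ Dt.L.lattice, ∃ w ∈ periodLattice Dt.f, z = (Dt.c : ℂ) * w) → Odd Dt.c →
          ∀ (β : ℤ) (ι : K →+* ℂ) (d₁ : KolyvaginHeegnerData Dt β ι 1), ¬ IsOfFinAddOrder d₁.derivedPoint →
            ∃ n : ℕ, Squarefree n ∧
              (∀ ℓ ∈ n.primeFactors, Zhang2014.IsKolyvaginPrime (W.conductorNorm ℤ) W K 2 ℓ ∧ CMInert W ℓ) ∧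
              Nonempty (KolyvaginHeegnerData Dt β ι n) ∧
              ∀ d : KolyvaginHeegnerData Dt β ι n,
                ¬ ∃ Q : (W.baseChange (ringClassField K ι n)).toAffine.Point, (2 : ℤ) • Q = d.derivedPoint) :
    CMKolyvaginConjectureAtInertTwo := by
  intro W _ _ _ hCM hin hρ hr hT K _ _ hK hodd h3 hH Dt hDt hc β ι d₁ hy
  exact (conclusion_iff_forall_data W hCM hK hodd h3 hH d₁).mpr
    (h W hCM hin hρ hr hT K hK hodd h3 hH Dt hDt hc β ι d₁ hy)

/-- **`CMKolyvaginConjectureAtInertTwo` (crux 24648, BY NAME) ⟺ ITS CANONICAL, DATUM-FREE FORM**: Kolyvagin's conjecture at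
`p = 2` on H₂ says that on every frame `(W, K, Dt, β, ι)` with `y_K = P(1)` of infinite order SOME square-free product `n` of
Zhang–Kolyvagin primes at `2` inert in `F` has `P(n) ∉ 2E(K[n])` for EVERY choice of Kolyvagin's auxiliary data (the class
`[P(n)] ∈ E(K[n])/2E(K[n])` is canonical, p799182). [cite: GrossLMS1991, §4 (4.1) and the remark that [P_n] is independent of S]
[cite: WZhang2014, §3.7] -/
theorem cmKolyvaginConjectureAtInertTwo_iff_forall_data :
    CMKolyvaginConjectureAtInertTwo ↔
    ∀ (W : WeierstrassCurve ℚ) [W.IsElliptic] [W.IsGloballyMinimal] [NeZero (W.conductorNorm ℤ)], W.HasCM →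
      CMInert W 2 → W.HasSurjectiveModNGaloisRep (2 : ℤ) → W.analyticRank = 1 → Odd W.tamagawaProduct →
      ∀ (K : Type) [Field K] [NumberField K], IsImaginaryQuadratic K → Odd (NumberField.discr K) →
        NumberField.discr K ≠ -3 → SatisfiesHeegnerHypothesis (W.conductorNorm ℤ) K →
        ∀ (Dt : ModularParametrizationData W (W.conductorNorm ℤ)),
          (∀ z ∈ Dt.L.lattice, ∃ w ∈ periodLattice Dt.f, z = (Dt.c : ℂ) * w) → Odd Dt.c →
          ∀ (β : ℤ) (ι : K →+* ℂ) (d₁ : KolyvaginHeegnerData Dt β ι 1), ¬ IsOfFinAddOrder d₁.derivedPoint →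
            ∃ n : ℕ, Squarefree n ∧
              (∀ ℓ ∈ n.primeFactors, Zhang2014.IsKolyvaginPrime (W.conductorNorm ℤ) W K 2 ℓ ∧ CMInert W ℓ) ∧
              Nonempty (KolyvaginHeegnerData Dt β ι n) ∧
              ∀ d : KolyvaginHeegnerData Dt β ι n,
                ¬ ∃ Q : (W.baseChange (ringClassField K ι n)).toAffine.Point, (2 : ℤ) • Q = d.derivedPoint :=
  ⟨forall_data_of_cmKolyvaginConjectureAtInertTwo, cmKolyvaginConjectureAtInertTwo_of_forall_data⟩

/-! ## §2 On CM-inert primes, SHALLOW (`M(ℓ) < 2`) means `ℓ ≡ 1 (mod 4)` -/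

/-- **`M(ℓ) < 2 ⟺ ℓ ≡ 1 (mod 4)` at a CM-inert Zhang–Kolyvagin prime at `2`** (`W/ℚ` globally minimal with CM): Deuring gives
`a_ℓ = 0` (tree `Rank1Residual.frobeniusTrace_eq_zero_of_hasCM_of_cmInert`; `ℓ ∤ N_E` is good reduction), so Zhang's index is
`M(ℓ) = v₂(gcd(ℓ+1, 0)) = v₂(ℓ+1)`, which is `< 2` iff `4 ∤ ℓ + 1` iff `ℓ ≡ 1 (mod 4)` for odd `ℓ`.
[cite: WZhang2014, Notations (xii)] [cite: Lang1987, Ch. 13 §4 Thm. 12] -/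
theorem kolyvaginIndex_two_lt_two_iff_mod_four_eq_one (W : WeierstrassCurve ℚ) [W.IsElliptic] [W.IsGloballyMinimal]
    (hCM : W.HasCM) {K : Type} [Field K] [NumberField K] {ℓ : ℕ}
    (hℓK : Zhang2014.IsKolyvaginPrime (W.conductorNorm ℤ) W K 2 ℓ) (hℓF : CMInert W ℓ) :
    Zhang2014.kolyvaginIndex W 2 ℓ < 2 ↔ ℓ % 4 = 1 := by
  obtain ⟨hℓ, hℓN, -, hℓ2, -, -⟩ := hℓK
  haveI : Fact ℓ.Prime := ⟨hℓ⟩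
  have hgood : W.HasGoodReductionAtPrime ℓ :=
    not_not.mp (mt (W.dvd_conductorNorm_iff_not_hasGoodReductionAtPrime ℓ).mpr hℓN)
  have ha : W.frobeniusTrace ℓ = 0 :=
    Summit.BirchSwinnertonDyer.Rank1Residual.frobeniusTrace_eq_zero_of_hasCM_of_cmInert hCM hℓ2 hgood hℓF
  have hidx : Zhang2014.kolyvaginIndex W 2 ℓ = padicValNat 2 (ℓ + 1) := by
    rw [Zhang2014.kolyvaginIndex, ha, Int.natAbs_zero, Nat.gcd_zero_right]
  have hodd : Odd ℓ := hℓ.odd_of_ne_two hℓ2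
  have h4 : 2 ^ 2 ∣ ℓ + 1 ↔ 2 ≤ padicValNat 2 (ℓ + 1) := padicValNat_dvd_iff_le (Nat.succ_ne_zero ℓ)
  rw [hidx]
  constructor
  · intro hlt
    have hn4 : ¬ 2 ^ 2 ∣ ℓ + 1 := fun h ↦ absurd (h4.mp h) (by omega)
    obtain ⟨r, hr⟩ := hodd
    omega
  · intro h1
    by_contra hge
    have hdvd : 2 ^ 2 ∣ ℓ + 1 := h4.mpr (by omega)
    omega

end Summit.BirchSwinnertonDyer.BirchSwinnertonDyer.Theorems.CMKolyvaginConjecturePositiveDepth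

end
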